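import Summits.ResolutionOfSingularities.ResolutionOfSingularities.Theorems.FrobeniusLadderFRationalResolutionVertexCertificateOfCharts
import Summits.ResolutionOfSingularities.ResolutionOfSingularities.Theorems.FrobeniusLadderFRationalResolutionClassOneFourthOneThree
import HarnessLib

/-!
# Crux `FrobeniusLadder.FRationalResolution` (stmt-ResolutionOfSingularities-15317), line `redirect`,
# stub `stub_diagonalizableQuotientResolution` — THE `A₂` VERTEX CHART: face and vertex slots of the cone monoid
# `Q = ⟨(3,0), (1,1), (0,3)⟩ ⊆ ℕ²` (item (β-cert-2) of MEMO-15317-leafhand2-g26 §4; the singular vertex chart of `1/5(1,4) = A₄`)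

As `…VeroneseTwoChartSlots` (p844019) for `A₁`, now for the `A₂` cone `Q = {(s,t) : 3 ∣ s + 2t} = ⟨(3,0),(1,1),(0,3)⟩`, which is NOT a
Veronese cone: its vertex certificate comes from `…VertexCertificateOfCharts.vertexCertificate_of_regular_cones` (p844071) and the
three FREE vertex charts of `A₂` (the matrices of `…ClassOneThirdOneTwo`), its faces from explicit face maps `ℕ × ℤ, ℤ² → ℤ²`.

* `freeChart_of_matrix_regular` — `…ClassOneFourthOneThree.freeChart_of_matrix` with the plain conclusion `∀ κ, IsRegularRing κ[ℕ²]`;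
* `aTwo_face_regular`, `aTwo_vertexCertificate`, ★★★ `aTwo_chartSlots`.

Honest label: combinatorial helper toward ONE leaf stub (no stub, crux or summit closed). No definitions, no named facts, no sorry.
[folklore; cite: CoxLittleSchenck2011, §1.2, §10.1]
-/

noncomputable section

-- single-problem summit: the doubled namespace component is forced
set_option linter.dupNamespace false

open AlgebraicGeometry
open Literature.AlgebraicGeometry.Resolution

namespace Summit.ResolutionOfSingularities.ResolutionOfSingularities.Theorems.FRationalResolution.ATwoChart

open ClassOneThirdOneTwo VeroneseTwoChart ConeCertificateGenerators

/-- The exponent of `p ∈ ℕⁿ` in `ℤⁿ`. -/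
local notation3 (prettyPrint := false) "toZ[" n "]" =>
  (Finsupp.mapRange.addMonoidHom (Nat.castAddMonoidHom ℤ) : (Fin n →₀ ℕ) →+ (Fin n →₀ ℤ))

/-- The generators of the `A₂` cone. -/
local notation3 (prettyPrint := false) "GA2" =>
  ({Finsupp.single 0 3, Finsupp.single 0 1 + Finsupp.single 1 1, Finsupp.single 1 3} : Set (Fin 2 →₀ ℕ))

/-- The `A₂` cone monoid. -/
local notation3 (prettyPrint := false) "QA2" =>
  AddSubmonoid.closure ({Finsupp.single 0 3, Finsupp.single 0 1 + Finsupp.single 1 1, Finsupp.single 1 3} : Set (Fin 2 →₀ ℕ))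

/-! ## §1 Free charts, regular form -/

/-- **A free vertex chart from a `2 × 2` matrix, with the plain conclusion `∀ κ, IsRegularRing κ[Q]`** (the input shape of
`vertexCertificate_of_regular_cones`). [folklore; cite: CoxLittleSchenck2011, §1.2] -/
theorem freeChart_of_matrix_regular (P : AddSubmonoid (Fin 2 →₀ ℕ)) (G : Set (Fin 2 →₀ ℕ)) (hGP : AddSubmonoid.closure G = P)
    (v : ↥P) (a' b' c' d' : ℤ) (hdet : a' * d' - b' * c' ≠ 0)
    (hgen : ∀ ι : ↥(⊤ : AddSubmonoid (Fin 2 →₀ ℕ)) →+ (Fin 2 →₀ ℤ), (∀ u, ι u =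
        Finsupp.single 0 (a' * ((u : Fin 2 →₀ ℕ) 0 : ℤ) + b' * ((u : Fin 2 →₀ ℕ) 1 : ℤ)) +
        Finsupp.single 1 (c' * ((u : Fin 2 →₀ ℕ) 0 : ℤ) + d' * ((u : Fin 2 →₀ ℕ) 1 : ℤ))) →
      (∀ g ∈ G, ∃ u : ↥(⊤ : AddSubmonoid (Fin 2 →₀ ℕ)), ι u = toZ[2] g) ∧
      (∀ g ∈ G, ∃ u : ↥(⊤ : AddSubmonoid (Fin 2 →₀ ℕ)), ι u = toZ[2] g - toZ[2] (v : Fin 2 →₀ ℕ)) ∧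
      (∀ u : ↥(⊤ : AddSubmonoid (Fin 2 →₀ ℕ)), (u : Fin 2 →₀ ℕ) ∈ Set.range (fun i : Fin 2 => (Finsupp.single i 1 : Fin 2 →₀ ℕ)) →
        ∃ (p : ↥P) (r : ℕ) (e : Fin r → ↥P), (∀ i, e i ≠ 0) ∧
          ι u = toZ[2] (p : Fin 2 →₀ ℕ) + ∑ i, (toZ[2] ((e i : ↥P) : Fin 2 →₀ ℕ) - toZ[2] (v : Fin 2 →₀ ℕ)))) :
    ∃ (n' : ℕ) (Q : AddSubmonoid (Fin n' →₀ ℕ)) (ι : ↥Q →+ (Fin 2 →₀ ℤ)) (_ : Function.Injective ι)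
      (_ : ∀ e : ↥P, e ≠ 0 → ∃ u : ↥Q, ι u = toZ[2] (e : Fin 2 →₀ ℕ) - toZ[2] (v : Fin 2 →₀ ℕ))
      (_ : ∀ p : ↥P, ∃ u : ↥Q, ι u = toZ[2] (p : Fin 2 →₀ ℕ))
      (_ : ∀ u : ↥Q, ∃ (p : ↥P) (r : ℕ) (e : Fin r → ↥P), (∀ i, e i ≠ 0) ∧
        ι u = toZ[2] (p : Fin 2 →₀ ℕ) + ∑ i, (toZ[2] ((e i : ↥P) : Fin 2 →₀ ℕ) - toZ[2] (v : Fin 2 →₀ ℕ))),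
      ∀ (κ : Type) [Field κ], IsRegularRing (AddMonoidAlgebra κ ↥Q) := by
  obtain ⟨ι, hι⟩ := exists_coneHom a' b' c' d'
  obtain ⟨hG1, hG2, hG3⟩ := hgen ι hι
  have hPQ := forall_exists_eq_of_generators P ⊤ ι (toZ[2]) G hGP hG1
  exact ⟨2, ⊤, ι, coneHom_injective hdet ι hι, forall_exists_eq_sub_of_generators P ⊤ ι (toZ[2]) G hGP _ hG2 hPQ, hPQ,
    forall_exists_decomp_of_generators P ⊤ ι (toZ[2]) _ _ (closure_range_single_one_eq_top 2) hG3,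
    fun κ _ => MonoidAlgebraLaurent.isRegularRing_monoidAlgebra_top κ 2⟩

/-! ## §2 The faces of the `A₂` cone -/

/-- **The faces of `QA2` at its three generators are regular over every field.** [folklore; cite: CoxLittleSchenck2011, §1.2] -/
theorem aTwo_face_regular (κ : Type) [Field κ] (u : ↥QA2) (hu : (u : Fin 2 →₀ ℕ) ∈ GA2) :
    IsRegularRing (Localization.Away (AddMonoidAlgebra.single u (1 : κ))) := by
  -- the generators as elements of `QA2`
  have m0 : (Finsupp.single 0 3 : Fin 2 →₀ ℕ) ∈ QA2 := AddSubmonoid.subset_closure (Or.inl rfl)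
  have m1 : (Finsupp.single 0 1 + Finsupp.single 1 1 : Fin 2 →₀ ℕ) ∈ QA2 := AddSubmonoid.subset_closure (Or.inr (Or.inl rfl))
  have m2 : (Finsupp.single 1 3 : Fin 2 →₀ ℕ) ∈ QA2 := AddSubmonoid.subset_closure (Or.inr (Or.inr rfl))
  have z0 : toZ[2] (Finsupp.single 0 3 : Fin 2 →₀ ℕ) = Finsupp.single 0 3 + Finsupp.single 1 0 := by ext i; fin_cases i <;> simp
  have z1 : toZ[2] (Finsupp.single 0 1 + Finsupp.single 1 1 : Fin 2 →₀ ℕ) = Finsupp.single 0 1 + Finsupp.single 1 1 := by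
    ext i; fin_cases i <;> simp
  have z2 : toZ[2] (Finsupp.single 1 3 : Fin 2 →₀ ℕ) = Finsupp.single 0 0 + Finsupp.single 1 3 := by ext i; fin_cases i <;> simp
  -- `hQM` for a face map is checked on the three generators
  have QMgen : ∀ {M : Type} [AddCommMonoid M] (ι' : M →+ (Fin 2 →₀ ℤ)),
      (∃ w, ι' w = Finsupp.single 0 3 + Finsupp.single 1 0) → (∃ w, ι' w = Finsupp.single 0 1 + Finsupp.single 1 1) →
      (∃ w, ι' w = Finsupp.single 0 0 + Finsupp.single 1 3) → ∀ q : ↥QA2, ∃ w, ι' w = toZ[2] (q : Fin 2 →₀ ℕ) := by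
    intro M _ ι' h0 h1 h2
    refine face_forall_exists_eq_of_generators QA2 ι' (toZ[2]) GA2 rfl ?_
    rintro q (h | h | h) <;> rw [h]
    · rw [z0]; exact h0
    · rw [z1]; exact h1
    · rw [z2]; exact h2
  rcases hu with h | h | h
  · -- `u = (3,0)`: face monoid `ℕ × ℤ`, `(x; y) ↦ (x + 3y, x)`
    have huZ : toZ[2] (u : Fin 2 →₀ ℕ) = Finsupp.single 0 3 + Finsupp.single 1 0 := by rw [h, z0]
    obtain ⟨ι', hι'⟩ := exists_faceHom₁ 1 3 1 0
    have hap : ∀ w, ι' w 0 = ((w.1 0 : ℕ) : ℤ) + 3 * w.2 0 ∧ ι' w 1 = ((w.1 0 : ℕ) : ℤ) := fun w => by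
      rw [hι']; refine ⟨by simp, by simp⟩
    have hinj : Function.Injective ι' := by
      intro w w' h
      obtain ⟨a0, a1⟩ := hap w
      obtain ⟨b0, b1⟩ := hap w'
      rw [h] at a0 a1
      have e₁ : ((w.1 0 : ℕ) : ℤ) = ((w'.1 0 : ℕ) : ℤ) := a1.symm.trans b1
      have e₂ : w.2 0 = w'.2 0 := by linarith [a0.symm.trans b0]
      refine Prod.ext ?_ ?_
      · exact Finsupp.ext fun i => by fin_cases i; exact_mod_cast e₁
      · exact Finsupp.ext fun i => by fin_cases i; exact e₂
    have hM : ∀ w, ∃ (q : ↥QA2) (k : ℕ), ι' w + k • toZ[2] (u : Fin 2 →₀ ℕ) = toZ[2] (q : Fin 2 →₀ ℕ) := by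
      refine face_forall_of_generators QA2 ι' (toZ[2] (u : Fin 2 →₀ ℕ)) (fun q : ↥QA2 => toZ[2] (q : Fin 2 →₀ ℕ)) (by simp)
        (fun q q' => by rw [AddSubmonoid.coe_add, map_add]) _ (closure_prodGenerators_eq_top 1 1) ?_
      rintro t ((⟨i, rfl⟩ | ⟨j, rfl⟩) | ⟨j, rfl⟩)
      · fin_cases i
        refine ⟨⟨_, m1⟩, 0, ?_⟩
        rw [zero_smul, add_zero, hι', z1]
        exact coord_eq _ _ _ (by simp) (by simp)
      · fin_cases j
        refine ⟨u, 0, ?_⟩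
        rw [zero_smul, add_zero, hι', huZ]
        exact coord_eq _ _ _ (by simp) (by simp)
      · fin_cases j
        refine ⟨0, 1, ?_⟩
        rw [one_smul, hι', huZ]
        ext i; fin_cases i <;> simp
    have hQM : ∀ q : ↥QA2, ∃ w, ι' w = toZ[2] (q : Fin 2 →₀ ℕ) :=
      QMgen ι' ⟨(0, Finsupp.single 0 1), by rw [hι']; exact coord_eq _ _ _ (by simp) (by simp)⟩
        ⟨(Finsupp.single 0 1, 0), by rw [hι']; exact coord_eq _ _ _ (by simp) (by simp)⟩
        ⟨(Finsupp.single 0 3, -Finsupp.single 0 1), by rw [hι']; exact coord_eq _ _ _ (by simp) (by simp)⟩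
    have hgM : ∃ w₀, ι' w₀ + toZ[2] (u : Fin 2 →₀ ℕ) = 0 := by
      refine ⟨(0, -Finsupp.single 0 1), ?_⟩
      rw [hι', huZ]
      ext i; fin_cases i <;> simp
    exact (MonoidAlgebraLaurent.isRegularRing_away_iff_of_monoid κ QA2 u ι' hinj hM hQM hgM).mpr
      (MonoidAlgebraLaurent.isRegularRing_monoidAlgebra_of_addEquiv κ (AddEquiv.refl _))
  · -- `u = (1,1)` (interior): face monoid `ℤ²`, `(y₀, y₁) ↦ (3y₀ + y₁, y₁)`
    have huZ : toZ[2] (u : Fin 2 →₀ ℕ) = Finsupp.single 0 1 + Finsupp.single 1 1 := by rw [h, z1]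
    obtain ⟨ι', hι'⟩ := exists_faceHom₂ 3 1 0 1
    have hap : ∀ w, ι' w 0 = 3 * w.2 0 + w.2 1 ∧ ι' w 1 = w.2 1 := fun w => by
      rw [hι']; refine ⟨by simp, by simp⟩
    have hinj : Function.Injective ι' := by
      intro w w' h
      obtain ⟨a0, a1⟩ := hap w
      obtain ⟨b0, b1⟩ := hap w'
      rw [h] at a0 a1
      have e₂ : w.2 1 = w'.2 1 := a1.symm.trans b1
      have e₁ : w.2 0 = w'.2 0 := by linarith [a0.symm.trans b0]
      refine Prod.ext (Subsingleton.elim _ _) ?_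
      exact Finsupp.ext fun i => by fin_cases i; exacts [e₁, e₂]
    have hM : ∀ w, ∃ (q : ↥QA2) (k : ℕ), ι' w + k • toZ[2] (u : Fin 2 →₀ ℕ) = toZ[2] (q : Fin 2 →₀ ℕ) := by
      refine face_forall_of_generators QA2 ι' (toZ[2] (u : Fin 2 →₀ ℕ)) (fun q : ↥QA2 => toZ[2] (q : Fin 2 →₀ ℕ)) (by simp)
        (fun q q' => by rw [AddSubmonoid.coe_add, map_add]) _ (closure_prodGenerators_eq_top 0 2) ?_
      rintro t ((⟨i, rfl⟩ | ⟨j, rfl⟩) | ⟨j, rfl⟩)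
      · exact i.elim0
      · fin_cases j
        · refine ⟨⟨_, m0⟩, 0, ?_⟩
          rw [zero_smul, add_zero, hι', z0]
          exact coord_eq _ _ _ (by simp) (by simp)
        · refine ⟨u, 0, ?_⟩
          rw [zero_smul, add_zero, hι', huZ]
          exact coord_eq _ _ _ (by simp) (by simp)
      · fin_cases j
        · refine ⟨⟨_, m2⟩, 3, ?_⟩
          rw [hι', huZ, z2]
          ext i; fin_cases i <;> simp
        · refine ⟨0, 1, ?_⟩
          rw [one_smul, hι', huZ]
          ext i; fin_cases i <;> simp
    have hQM : ∀ q : ↥QA2, ∃ w, ι' w = toZ[2] (q : Fin 2 →₀ ℕ) :=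
      QMgen ι' ⟨(0, Finsupp.single 0 1), by rw [hι']; exact coord_eq _ _ _ (by simp) (by simp)⟩
        ⟨(0, Finsupp.single 1 1), by rw [hι']; exact coord_eq _ _ _ (by simp) (by simp)⟩
        ⟨(0, -Finsupp.single 0 1 + Finsupp.single 1 3), by rw [hι']; exact coord_eq _ _ _ (by simp) (by simp)⟩
    have hgM : ∃ w₀, ι' w₀ + toZ[2] (u : Fin 2 →₀ ℕ) = 0 := by
      refine ⟨(0, -Finsupp.single 1 1), ?_⟩
      rw [hι', huZ]
      ext i; fin_cases i <;> simp
    exact (MonoidAlgebraLaurent.isRegularRing_away_iff_of_monoid κ QA2 u ι' hinj hM hQM hgM).mpr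
      (MonoidAlgebraLaurent.isRegularRing_monoidAlgebra_of_addEquiv κ (AddEquiv.refl _))
  · -- `u = (0,3)`: face monoid `ℕ × ℤ`, `(x; y) ↦ (x, x + 3y)`
    have huZ : toZ[2] (u : Fin 2 →₀ ℕ) = Finsupp.single 0 0 + Finsupp.single 1 3 := by rw [h, z2]
    obtain ⟨ι', hι'⟩ := exists_faceHom₁ 1 0 1 3
    have hap : ∀ w, ι' w 0 = ((w.1 0 : ℕ) : ℤ) ∧ ι' w 1 = ((w.1 0 : ℕ) : ℤ) + 3 * w.2 0 := fun w => by
      rw [hι']; refine ⟨by simp, by simp⟩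
    have hinj : Function.Injective ι' := by
      intro w w' h
      obtain ⟨a0, a1⟩ := hap w
      obtain ⟨b0, b1⟩ := hap w'
      rw [h] at a0 a1
      have e₁ : ((w.1 0 : ℕ) : ℤ) = ((w'.1 0 : ℕ) : ℤ) := a0.symm.trans b0
      have e₂ : w.2 0 = w'.2 0 := by linarith [a1.symm.trans b1]
      refine Prod.ext ?_ ?_
      · exact Finsupp.ext fun i => by fin_cases i; exact_mod_cast e₁
      · exact Finsupp.ext fun i => by fin_cases i; exact e₂
    have hM : ∀ w, ∃ (q : ↥QA2) (k : ℕ), ι' w + k • toZ[2] (u : Fin 2 →₀ ℕ) = toZ[2] (q : Fin 2 →₀ ℕ) := by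
      refine face_forall_of_generators QA2 ι' (toZ[2] (u : Fin 2 →₀ ℕ)) (fun q : ↥QA2 => toZ[2] (q : Fin 2 →₀ ℕ)) (by simp)
        (fun q q' => by rw [AddSubmonoid.coe_add, map_add]) _ (closure_prodGenerators_eq_top 1 1) ?_
      rintro t ((⟨i, rfl⟩ | ⟨j, rfl⟩) | ⟨j, rfl⟩)
      · fin_cases i
        refine ⟨⟨_, m1⟩, 0, ?_⟩
        rw [zero_smul, add_zero, hι', z1]
        exact coord_eq _ _ _ (by simp) (by simp)
      · fin_cases j
        refine ⟨u, 0, ?_⟩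
        rw [zero_smul, add_zero, hι', huZ]
        exact coord_eq _ _ _ (by simp) (by simp)
      · fin_cases j
        refine ⟨0, 1, ?_⟩
        rw [one_smul, hι', huZ]
        ext i; fin_cases i <;> simp
    have hQM : ∀ q : ↥QA2, ∃ w, ι' w = toZ[2] (q : Fin 2 →₀ ℕ) :=
      QMgen ι' ⟨(Finsupp.single 0 3, -Finsupp.single 0 1), by rw [hι']; exact coord_eq _ _ _ (by simp) (by simp)⟩
        ⟨(Finsupp.single 0 1, 0), by rw [hι']; exact coord_eq _ _ _ (by simp) (by simp)⟩
        ⟨(0, Finsupp.single 0 1), by rw [hι']; exact coord_eq _ _ _ (by simp) (by simp)⟩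
    have hgM : ∃ w₀, ι' w₀ + toZ[2] (u : Fin 2 →₀ ℕ) = 0 := by
      refine ⟨(0, -Finsupp.single 0 1), ?_⟩
      rw [hι', huZ]
      ext i; fin_cases i <;> simp
    exact (MonoidAlgebraLaurent.isRegularRing_away_iff_of_monoid κ QA2 u ι' hinj hM hQM hgM).mpr
      (MonoidAlgebraLaurent.isRegularRing_monoidAlgebra_of_addEquiv κ (AddEquiv.refl _))

/-! ## §3 The vertex certificate of the `A₂` cone -/

/-- **The point blow-up of `K[x³, xy, y³] ⊆ K[x,y]` is regular**, from the three free vertex charts of the `A₂` cone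
(`vertexCertificate_of_regular_cones`). [folklore; cite: CoxLittleSchenck2011, §10.1] -/
theorem aTwo_vertexCertificate (K : Type) [Field K] :
    Scheme.IsRegular (affineBlowup (Ideal.span {w : ↥(Algebra.adjoin K
      ((fun d : Fin 2 →₀ ℕ => MvPolynomial.monomial d (1 : K)) '' GA2)) |
      ∃ d ∈ GA2, (w : MvPolynomial (Fin 2) K) = MvPolynomial.monomial d 1})) := by
  have m0 : (Finsupp.single 0 3 : Fin 2 →₀ ℕ) ∈ QA2 := AddSubmonoid.subset_closure (Or.inl rfl)
  have m1 : (Finsupp.single 0 1 + Finsupp.single 1 1 : Fin 2 →₀ ℕ) ∈ QA2 := AddSubmonoid.subset_closure (Or.inr (Or.inl rfl))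
  have m2 : (Finsupp.single 1 3 : Fin 2 →₀ ℕ) ∈ QA2 := AddSubmonoid.subset_closure (Or.inr (Or.inr rfl))
  have hG0 : (0 : Fin 2 →₀ ℕ) ∉ GA2 := by
    rintro (h | h | h)
    · have := DFunLike.congr_fun h 0; simp at this
    · have := DFunLike.congr_fun h 0; simp at this
    · have := DFunLike.congr_fun h 1; simp at this
  let gen : Fin 3 → ↥QA2 := ![⟨_, m0⟩, ⟨_, m1⟩, ⟨_, m2⟩]
  have hgen0 : ((gen 0 : ↥QA2) : Fin 2 →₀ ℕ) = Finsupp.single 0 3 := rfl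
  have hgen1 : ((gen 1 : ↥QA2) : Fin 2 →₀ ℕ) = Finsupp.single 0 1 + Finsupp.single 1 1 := rfl
  have hgen2 : ((gen 2 : ↥QA2) : Fin 2 →₀ ℕ) = Finsupp.single 1 3 := rfl
  have hgenG : ∀ i, ((gen i : ↥QA2) : Fin 2 →₀ ℕ) ∈ GA2 := by
    intro i; fin_cases i
    · exact Or.inl hgen0
    · exact Or.inr (Or.inl hgen1)
    · exact Or.inr (Or.inr hgen2)
  have hGgen : ∀ g ∈ GA2, ∃ i, ((gen i : ↥QA2) : Fin 2 →₀ ℕ) = g := by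
    rintro g (rfl | rfl | rfl)
    exacts [⟨0, hgen0⟩, ⟨1, hgen1⟩, ⟨2, hgen2⟩]
  have hv0 : ∀ j, gen j ≠ 0 := by
    intro j h
    have h' : ((gen j : ↥QA2) : Fin 2 →₀ ℕ) = 0 := by rw [h]; rfl
    exact hG0 (h' ▸ hgenG j)
  have mem : ∀ w : Fin 2 →₀ ℕ, w ∈ (⊤ : AddSubmonoid (Fin 2 →₀ ℕ)) := fun w => AddSubmonoid.mem_top w
  refine MonoidAlgebraLaurent.vertexCertificate_of_regular_cones K QA2 GA2 hG0 rfl gen hgenG hGgen gen hv0 1 le_rfl id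
    (fun _ => 0) (fun _ => le_rfl) (fun _ => Fin.elim0) (fun _ l => l.elim0) (fun i => by simp) fun j => ?_
  -- the three free vertex charts of `A₂` (matrices of `…ClassOneThirdOneTwo`), specialised to `K`
  have spec : ∀ (v : ↥QA2) (a' b' c' d' : ℤ), a' * d' - b' * c' ≠ 0 →
      (∀ ι : ↥(⊤ : AddSubmonoid (Fin 2 →₀ ℕ)) →+ (Fin 2 →₀ ℤ), (∀ u, ι u =
          Finsupp.single 0 (a' * ((u : Fin 2 →₀ ℕ) 0 : ℤ) + b' * ((u : Fin 2 →₀ ℕ) 1 : ℤ)) +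
          Finsupp.single 1 (c' * ((u : Fin 2 →₀ ℕ) 0 : ℤ) + d' * ((u : Fin 2 →₀ ℕ) 1 : ℤ))) →
        (∀ g ∈ GA2, ∃ u : ↥(⊤ : AddSubmonoid (Fin 2 →₀ ℕ)), ι u = toZ[2] g) ∧
        (∀ g ∈ GA2, ∃ u : ↥(⊤ : AddSubmonoid (Fin 2 →₀ ℕ)), ι u = toZ[2] g - toZ[2] (v : Fin 2 →₀ ℕ)) ∧
        (∀ u : ↥(⊤ : AddSubmonoid (Fin 2 →₀ ℕ)), (u : Fin 2 →₀ ℕ) ∈ Set.range (fun i : Fin 2 => (Finsupp.single i 1 : Fin 2 →₀ ℕ)) →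
          ∃ (p : ↥QA2) (r : ℕ) (e : Fin r → ↥QA2), (∀ i, e i ≠ 0) ∧
            ι u = toZ[2] (p : Fin 2 →₀ ℕ) + ∑ i, (toZ[2] ((e i : ↥QA2) : Fin 2 →₀ ℕ) - toZ[2] (v : Fin 2 →₀ ℕ)))) →
      ∃ (n' : ℕ) (Q : AddSubmonoid (Fin n' →₀ ℕ)) (ι : ↥Q →+ (Fin 2 →₀ ℤ)) (_ : Function.Injective ι)
        (_ : ∀ e : ↥QA2, e ≠ 0 → ∃ u : ↥Q, ι u = toZ[2] (e : Fin 2 →₀ ℕ) - toZ[2] (v : Fin 2 →₀ ℕ))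
        (_ : ∀ p : ↥QA2, ∃ u : ↥Q, ι u = toZ[2] (p : Fin 2 →₀ ℕ))
        (_ : ∀ u : ↥Q, ∃ (p : ↥QA2) (r : ℕ) (e : Fin r → ↥QA2), (∀ i, e i ≠ 0) ∧
          ι u = toZ[2] (p : Fin 2 →₀ ℕ) + ∑ i, (toZ[2] ((e i : ↥QA2) : Fin 2 →₀ ℕ) - toZ[2] (v : Fin 2 →₀ ℕ))),
        IsRegularRing (AddMonoidAlgebra K ↥Q) := by
    intro v a' b' c' d' hdet hgen
    obtain ⟨n', Q, ι, hι, hE, hPQ, hQ, hreg⟩ := freeChart_of_matrix_regular QA2 GA2 rfl v a' b' c' d' hdet hgen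
    exact ⟨n', Q, ι, hι, hE, hPQ, hQ, hreg K⟩
  fin_cases j
  · refine spec (gen 0) 3 (-2) 0 1 (by norm_num) fun ι hι => ⟨?_, ?_, ?_⟩
    · rintro g (rfl | rfl | rfl)
      · exact ⟨⟨Finsupp.single 0 1, mem _⟩, coneHom_eq ι hι _ _ (by simp) (by simp)⟩
      · exact ⟨⟨Finsupp.single 0 1 + Finsupp.single 1 1, mem _⟩, coneHom_eq ι hι _ _ (by simp) (by simp)⟩
      · exact ⟨⟨Finsupp.single 0 2 + Finsupp.single 1 3, mem _⟩, coneHom_eq ι hι _ _ (by simp) (by simp)⟩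
    · rintro g (rfl | rfl | rfl)
      · exact ⟨0, by rw [map_zero, hgen0, sub_self]⟩
      · exact ⟨⟨Finsupp.single 1 1, mem _⟩, coneHom_eq ι hι _ _ (by simp [hgen0]) (by simp [hgen0])⟩
      · exact ⟨⟨Finsupp.single 0 1 + Finsupp.single 1 3, mem _⟩, coneHom_eq ι hι _ _ (by simp [hgen0]) (by simp [hgen0])⟩
    · rintro u ⟨i, hi⟩
      fin_cases i
      · refine ⟨gen 0, 0, Fin.elim0, fun i => i.elim0, ?_⟩
        rw [Finset.univ_eq_empty, Finset.sum_empty, add_zero]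
        exact coneHom_eq ι hι _ _ (by simp [← hi, hgen0]) (by simp [← hi, hgen0])
      · refine ⟨0, 1, ![gen 1], fun i => by fin_cases i; exact hv0 1, ?_⟩
        rw [Fin.sum_univ_one]
        exact coneHom_eq ι hι _ _ (by simp [← hi, hgen0, hgen1]) (by simp [← hi, hgen0, hgen1])
  · refine spec (gen 1) 2 (-1) (-1) 2 (by norm_num) fun ι hι => ⟨?_, ?_, ?_⟩
    · rintro g (rfl | rfl | rfl)
      · exact ⟨⟨Finsupp.single 0 2 + Finsupp.single 1 1, mem _⟩, coneHom_eq ι hι _ _ (by simp) (by simp)⟩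
      · exact ⟨⟨Finsupp.single 0 1 + Finsupp.single 1 1, mem _⟩, coneHom_eq ι hι _ _ (by simp) (by simp)⟩
      · exact ⟨⟨Finsupp.single 0 1 + Finsupp.single 1 2, mem _⟩, coneHom_eq ι hι _ _ (by simp) (by simp)⟩
    · rintro g (rfl | rfl | rfl)
      · exact ⟨⟨Finsupp.single 0 1, mem _⟩, coneHom_eq ι hι _ _ (by simp [hgen1]) (by simp [hgen1])⟩
      · exact ⟨0, by rw [map_zero, hgen1, sub_self]⟩
      · exact ⟨⟨Finsupp.single 1 1, mem _⟩, coneHom_eq ι hι _ _ (by simp [hgen1]) (by simp [hgen1])⟩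
    · rintro u ⟨i, hi⟩
      fin_cases i
      · refine ⟨0, 1, ![gen 0], fun i => by fin_cases i; exact hv0 0, ?_⟩
        rw [Fin.sum_univ_one]
        exact coneHom_eq ι hι _ _ (by simp [← hi, hgen0, hgen1]) (by simp [← hi, hgen0, hgen1])
      · refine ⟨0, 1, ![gen 2], fun i => by fin_cases i; exact hv0 2, ?_⟩
        rw [Fin.sum_univ_one]
        exact coneHom_eq ι hι _ _ (by simp [← hi, hgen1, hgen2]) (by simp [← hi, hgen1, hgen2])
  · refine spec (gen 2) 1 0 (-2) 3 (by norm_num) fun ι hι => ⟨?_, ?_, ?_⟩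
    · rintro g (rfl | rfl | rfl)
      · exact ⟨⟨Finsupp.single 0 3 + Finsupp.single 1 2, mem _⟩, coneHom_eq ι hι _ _ (by simp) (by simp)⟩
      · exact ⟨⟨Finsupp.single 0 1 + Finsupp.single 1 1, mem _⟩, coneHom_eq ι hι _ _ (by simp) (by simp)⟩
      · exact ⟨⟨Finsupp.single 1 1, mem _⟩, coneHom_eq ι hι _ _ (by simp) (by simp)⟩
    · rintro g (rfl | rfl | rfl)
      · exact ⟨⟨Finsupp.single 0 3 + Finsupp.single 1 1, mem _⟩, coneHom_eq ι hι _ _ (by simp [hgen2]) (by simp [hgen2])⟩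
      · exact ⟨⟨Finsupp.single 0 1, mem _⟩, coneHom_eq ι hι _ _ (by simp [hgen2]) (by simp [hgen2])⟩
      · exact ⟨0, by rw [map_zero, hgen2, sub_self]⟩
    · rintro u ⟨i, hi⟩
      fin_cases i
      · refine ⟨0, 1, ![gen 1], fun i => by fin_cases i; exact hv0 1, ?_⟩
        rw [Fin.sum_univ_one]
        exact coneHom_eq ι hι _ _ (by simp [← hi, hgen1, hgen2]) (by simp [← hi, hgen1, hgen2])
      · refine ⟨gen 2, 0, Fin.elim0, fun i => i.elim0, ?_⟩
        rw [Finset.univ_eq_empty, Finset.sum_empty, add_zero]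
        exact coneHom_eq ι hι _ _ (by simp [← hi, hgen2]) (by simp [← hi, hgen2])

/-- ★★★ **THE SLOTS OF THE `A₂` VERTEX CHART** `Q = ⟨(3,0),(1,1),(0,3)⟩`: `G_Q` finite, `0 ∉ G_Q`, faces regular over every field, vertex
certificate over every field (the second disjunct of a vertex chart of `…hasResolution_of_isolated_fixedPoints_of_mixedConeCertificate`,
with `closure G_Q = Q` by `rfl`). [folklore; cite: CoxLittleSchenck2011, §10.1] -/
theorem aTwo_chartSlots :
    (GA2).Finite ∧ (0 : Fin 2 →₀ ℕ) ∉ GA2 ∧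
    (∀ (κ : Type) [Field κ], ∀ u : ↥QA2, (u : Fin 2 →₀ ℕ) ∈ GA2 →
      IsRegularRing (Localization.Away (AddMonoidAlgebra.single u (1 : κ)))) ∧
    (∀ (K : Type) [Field K], Scheme.IsRegular (affineBlowup (Ideal.span {w : ↥(Algebra.adjoin K
      ((fun d : Fin 2 →₀ ℕ => MvPolynomial.monomial d (1 : K)) '' GA2)) |
      ∃ d ∈ GA2, (w : MvPolynomial (Fin 2) K) = MvPolynomial.monomial d 1}))) := by
  refine ⟨((Set.finite_singleton _).insert _).insert _, ?_, fun κ _ u hu => aTwo_face_regular κ u hu,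
    fun K _ => aTwo_vertexCertificate K⟩
  rintro (h | h | h)
  · have := DFunLike.congr_fun h 0; simp at this
  · have := DFunLike.congr_fun h 0; simp at this
  · have := DFunLike.congr_fun h 1; simp at this

end Summit.ResolutionOfSingularities.ResolutionOfSingularities.Theorems.FRationalResolution.ATwoChart

end
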